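import Summits.Schanuel.Schanuel.Theorems.RootDecomp1KPiScale03

/-!
# RootDecomp1KPiScale — lens 6, generation 20 «NESTERENKO-MEASURED SCALE π» (frame G20: lane T = the hypothesis-free DISCHARGE of the strong measure (31) at ω̄(e^{−2π}) from the tree-proved Nesterenko Ch. 3 Thm 5.1 / Prop 4.11 / Prop 4.8 ⇒ `LogPowMeasure ![π, e^π]`; lane F = K-R27 (F₊) cells on the π-lines for every log-hyper-Liouville ratio) — EDITION 2 §8 ADDENDUM (bookkeeping continuation of lane T per VERDICT L1986 / K-R29 (i): `LogPowMeasure ![e^{−2π}, π]`, `LogPowMeasure θπ`, the literal `LogPowMeasure ![π, e^π]`, and the tree's π-anchor cells with the h52 binder removed — all hypothesis-free) — continuation (RootDecomp1KPiScale04): §8a reversal transfer `logPowMeasure_revScale` + §8b `LogPowMeasure (e^{−2π}, π)` and the integer-anchor π-cells binder-free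

(lens-6 g20 `PiScale.lean` EDITION 2 [HOME/decomp-schanuel-lens-6/g20/ sha256 27ead95c…, 1257 l = edition 1 87044252… verbatim (only a §8 paragraph added to the module docstring) + §8 appended ll. 715–1254; NOTE/EDITION 2 L1994, REQUEST L1995 (+ correction L1996), critic @@ACK@@]; port by census-1 gen 17 as `RootDecomp1KPiScale04`–`05` after 01–03 (from edition 1): 04 = §8a reversal transfer (`revExp`, `revPoly`, `logPowMeasure_revScale`) + §8b `θq = (e^{−2π}, π)`, `logPowMeasure_thetaq`, `mvWeakMeasure_thetaq`, `sb_three_of_piIntAnchor_free`, `sb_three_one_pi_any_free`; 05 = §8c re-indexing + the square-root step (`logPowMeasure_comp_of_injective`, `logPowMeasure_swap`, `sgnTwist`, `sqNorm`, `halfExp`, `sqDesc`, `logPowMeasure_of_sq`) + §8d `logPowMeasure_pi_expPi_sq`, `logPowMeasure_θπ`, `mvWeakMeasure_θπ_free`, THE LITERAL `logPowMeasure_pi_expPi : LogPowMeasure ![π, e^π]`, `mvWeakMeasure_pi_expPi_free`, `sb_three_of_piLatAnchor_free`, `sb_three_of_pi_cexp_pi_free`.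
PORT EDITS: the three `set_option linter.*` dropped; 24 one-line docstrings (statement read-outs); `weight_eq` / `exp_le_of_totalDegree_le` private (+ per-part private copies); statements and proofs verbatim. `--supports stmt-Schanuel-33364`; no census credit; rung 0.)
-/

noncomputable section

open Complex IntermediateField
open MvPolynomial (aeval rename X C)
open Literature.NumberTheory.Transcendental
open Literature.NumberTheory.Transcendental.Nesterenko
open Literature.Barriers.Schanuel
open Summit.Schanuel.Schanuel.Theorems.RootDecomp1KHyper
open Summit.Schanuel.Schanuel.Theorems.RootDecomp1KHyper.HyperCell
open Summit.Schanuel.Schanuel.Theorems.RootDecomp1KGeneric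
open Summit.Schanuel.Schanuel.Theorems.RootDecomp1KRelLiouvilleCell
open Summit.Schanuel.Schanuel.Theorems.RootDecomp1KDarkLogSq
open Summit.Schanuel.Schanuel.Theorems.RootDecomp1KHyper.HyperCell.LatCell.Bilog (mvlen_rename)

namespace Summit.Schanuel.Schanuel.Theorems.RootDecomp1KPiScale

/-! ## §8  ADDENDUM (edition 2 — bookkeeping continuation of lane T per VERDICT L1986 / K-R29 (i); no credit asked)

§8a reversal transfer `(x, y) ↦ (x, a / y)` of log-power measures; §8b `LogPowMeasure (e^{−2π}, π)` HYPOTHESIS-FREE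
and the tree's integer-anchor cells `LatCell.sb_three_of_piIntAnchor'` / `LatCell.sb_three_one_pi_any'` (Hyper40: the
literal M2 cell `(1, π, y)`, ANY `y`) binder-free; §8c re-indexing and the SQUARE-ROOT STEP (norm `B(u, y)·B(−u, y)`,
a polynomial in `u²`); §8d `LogPowMeasure θπ` (`θπ = (e^{π}, π)`), the LITERAL `LogPowMeasure (π, e^{π})`, and
Hyper36 / PiCells / Hyper40's `mvWeakMeasure_θπ`, `mvWeakMeasure_pi_expPi_of_cor52`, `sb_three_of_piLatAnchor`,
`sb_three_of_pi_cexp_pi` with their `h52` binder REMOVED.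

### §8a  Reversal transfer of a log-power measure -/

section Rev
open MvPolynomial

/-- Exponent map of the reversal `y ↦ a / y` in the second variable at degree budget `d`:
`(m₀, m₁) ↦ (m₀, d − m₁)`. -/
noncomputable def revExp (d : ℕ) (m : Fin 2 →₀ ℕ) : Fin 2 →₀ ℕ :=
  Finsupp.single 0 (m 0) + Finsupp.single 1 (d - m 1)

/-- `revExp d m 0 = m 0`. -/
theorem revExp_zero (d : ℕ) (m : Fin 2 →₀ ℕ) : revExp d m 0 = m 0 := by
  simp [revExp, Finsupp.add_apply]

/-- `revExp d m 1 = d - m 1`. -/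
theorem revExp_one (d : ℕ) (m : Fin 2 →₀ ℕ) : revExp d m 1 = d - m 1 := by
  simp [revExp, Finsupp.add_apply]

/-- `m = m'`. -/
theorem revExp_inj {d : ℕ} {m m' : Fin 2 →₀ ℕ} (hm : m 1 ≤ d) (hm' : m' 1 ≤ d)
    (h : revExp d m = revExp d m') : m = m' := by
  have h0 := congrArg (fun f => f 0) h
  have h1 := congrArg (fun f => f 1) h
  simp only [revExp_zero, revExp_one] at h0 h1
  ext i
  match i with
  | 0 => exact h0
  | 1 => omega

/-- In total degree `≤ d` every exponent is `≤ d`. -/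
private theorem exp_le_of_totalDegree_le {B : MvPolynomial (Fin 2) ℤ} {d : ℕ} (hB : B.totalDegree ≤ d)
    {m : Fin 2 →₀ ℕ} (hm : m ∈ B.support) (i : Fin 2) : m i ≤ d :=
  ((monomial_le_degreeOf i hm).trans (degreeOf_le_totalDegree B i)).trans hB

/-- The reversed polynomial `B^{rev}(x, y) := Σ_m c_m · a^{m₁} · x^{m₀} · y^{d − m₁}`, so that
`B^{rev}(x, y) = y^d · B(x, a / y)` when `deg B ≤ d`. -/
noncomputable def revPoly (d : ℕ) (a : ℤ) (B : MvPolynomial (Fin 2) ℤ) : MvPolynomial (Fin 2) ℤ :=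
  ∑ m ∈ B.support, monomial (revExp d m) (B.coeff m * a ^ (m 1))

/-- `(revPoly d a B).coeff (revExp d m₀) = B.coeff m₀ * a ^ (m₀ 1)`. -/
theorem coeff_revPoly {d : ℕ} (a : ℤ) {B : MvPolynomial (Fin 2) ℤ} (hB : B.totalDegree ≤ d)
    {m₀ : Fin 2 →₀ ℕ} (hm₀ : m₀ ∈ B.support) :
    (revPoly d a B).coeff (revExp d m₀) = B.coeff m₀ * a ^ (m₀ 1) := by
  classical
  rw [revPoly, coeff_sum, Finset.sum_eq_single_of_mem m₀ hm₀]
  · rw [coeff_monomial, if_pos rfl]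
  · intro m hm hne
    rw [coeff_monomial, if_neg]
    intro h
    exact hne (revExp_inj (exp_le_of_totalDegree_le hB hm 1)
      (exp_le_of_totalDegree_le hB hm₀ 1) h)

/-- `revPoly d a B ≠ 0`. -/
theorem revPoly_ne_zero {d : ℕ} {a : ℤ} (ha : a ≠ 0) {B : MvPolynomial (Fin 2) ℤ} (hB0 : B ≠ 0)
    (hB : B.totalDegree ≤ d) : revPoly d a B ≠ 0 := by
  obtain ⟨m₀, hm₀⟩ := MvPolynomial.ne_zero_iff.mp hB0
  intro h
  have hc := coeff_revPoly a hB (mem_support_iff.mpr hm₀)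
  rw [h, coeff_zero] at hc
  exact mul_ne_zero hm₀ (pow_ne_zero _ ha) hc.symm

/-- `mvlen (revPoly d a B) ≤ |a| ^ d * mvlen B`. -/
theorem mvlen_revPoly_le {d : ℕ} {a : ℤ} (ha : a ≠ 0) {B : MvPolynomial (Fin 2) ℤ}
    (hB : B.totalDegree ≤ d) : mvlen (revPoly d a B) ≤ |a| ^ d * mvlen B := by
  calc mvlen (revPoly d a B)
      ≤ ∑ m ∈ B.support, mvlen (monomial (revExp d m) (B.coeff m * a ^ (m 1))) :=
        mvlen_sum_le _ _
    _ = ∑ m ∈ B.support, |B.coeff m| * |a| ^ (m 1) := by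
        refine Finset.sum_congr rfl fun m _ => ?_
        rw [mvlen_monomial, abs_mul, abs_pow]
    _ ≤ ∑ m ∈ B.support, |B.coeff m| * |a| ^ d :=
        Finset.sum_le_sum fun m hm => mul_le_mul_of_nonneg_left
          (pow_le_pow_right₀ (Int.one_le_abs ha) (exp_le_of_totalDegree_le hB hm 1)) (abs_nonneg _)
    _ = |a| ^ d * mvlen B := by
        rw [mvlen, Finset.mul_sum]
        exact Finset.sum_congr rfl fun m _ => mul_comm _ _

/-- `(revPoly d a B).totalDegree ≤ 2 * d`. -/
theorem totalDegree_revPoly_le {d : ℕ} (a : ℤ) {B : MvPolynomial (Fin 2) ℤ}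
    (hB : B.totalDegree ≤ d) : (revPoly d a B).totalDegree ≤ 2 * d := by
  rw [revPoly]
  refine (totalDegree_finsetSum _ _).trans (Finset.sup_le fun m hm => ?_)
  have h0 : m 0 ≤ d := exp_le_of_totalDegree_le hB hm 0
  have hsum : ((revExp d m).sum fun _ e => e) = m 0 + (d - m 1) := by
    rw [revExp, Finsupp.sum_add_index' (fun _ => rfl) (fun _ _ _ => rfl),
      Finsupp.sum_single_index rfl, Finsupp.sum_single_index rfl]
  calc (monomial (revExp d m) (B.coeff m * a ^ (m 1))).totalDegree
      ≤ (revExp d m).sum fun _ e => e := totalDegree_monomial_le _ _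
    _ = m 0 + (d - m 1) := hsum
    _ ≤ 2 * d := by omega

/-- `monomial (revExp d m) c = C c * X 0 ^ (m 0) * X 1 ^ (d - m 1)`. -/
theorem monomial_revExp_eq (d : ℕ) (m : Fin 2 →₀ ℕ) (c : ℤ) :
    monomial (revExp d m) c = C c * X 0 ^ (m 0) * X 1 ^ (d - m 1) := by
  rw [revExp, C_mul_X_pow_eq_monomial, X_pow_eq_monomial, monomial_mul, mul_one]

/-- **Evaluation of the reversal**: `B^{rev}(x, y) = y^d · B(x, a / y)` (`y ≠ 0`, `deg B ≤ d`). -/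
theorem aeval_revPoly {d : ℕ} (a : ℤ) {B : MvPolynomial (Fin 2) ℤ} (hB : B.totalDegree ≤ d)
    (x y : ℂ) (hy : y ≠ 0) :
    aeval ![x, y] (revPoly d a B) = y ^ d * aeval ![x, (a : ℂ) / y] B := by
  have hR : aeval ![x, (a : ℂ) / y] B =
      ∑ m ∈ B.support, ((B.coeff m : ℤ) : ℂ) * (x ^ (m 0) * ((a : ℂ) / y) ^ (m 1)) := by
    rw [MvPolynomial.aeval_def, MvPolynomial.eval₂_eq']
    refine Finset.sum_congr rfl fun m _ => ?_
    rw [Fin.prod_univ_two]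
    simp [Matrix.cons_val_zero, Matrix.cons_val_one]
  rw [hR, Finset.mul_sum, revPoly, map_sum]
  refine Finset.sum_congr rfl fun m hm => ?_
  have h1 : m 1 ≤ d := exp_le_of_totalDegree_le hB hm 1
  rw [monomial_revExp_eq]
  simp only [map_mul, map_pow, aeval_C, aeval_X, Matrix.cons_val_zero, Matrix.cons_val_one,
    algebraMap_int_eq, Int.coe_castRingHom]
  have hyd : y ^ d = y ^ (d - m 1) * y ^ (m 1) := by rw [← pow_add, Nat.sub_add_cancel h1]
  rw [hyd, div_pow]
  field_simp

/-- **Reversal transfer**: a log-power measure at `(x, y)`, `y ≠ 0`, gives one at `(x, a / y)` for every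
non-zero integer `a` (same `k`; `C ↦ C·(1 + d·log|a|)^k + d·|log|y||`). -/
theorem logPowMeasure_revScale {x y : ℂ} (hy : y ≠ 0) {a : ℤ} (ha : a ≠ 0)
    (h : LogPowMeasure ![x, y]) : LogPowMeasure ![x, (a : ℂ) / y] := by
  intro d
  obtain ⟨C, k, hC, hm⟩ := h (2 * d)
  have ha1 : (1 : ℝ) ≤ |(a : ℝ)| := by exact_mod_cast Int.one_le_abs ha
  have hla : 0 ≤ Real.log |(a : ℝ)| := Real.log_nonneg ha1
  set Λa : ℝ := 1 + d * Real.log |(a : ℝ)| with hΛa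
  have hdla : 0 ≤ (d : ℝ) * Real.log |(a : ℝ)| := mul_nonneg (Nat.cast_nonneg _) hla
  have hΛa1 : 1 ≤ Λa := by rw [hΛa]; linarith
  set ly : ℝ := |Real.log ‖y‖| with hly
  have hdly : 0 ≤ (d : ℝ) * ly := mul_nonneg (Nat.cast_nonneg _) (abs_nonneg _)
  refine ⟨C * Λa ^ k + d * ly, k,
    add_pos_of_pos_of_nonneg (mul_pos hC (pow_pos (by linarith) _)) hdly, fun P hP hdeg => ?_⟩
  set R := revPoly d a P with hRdef
  have hR0 : R ≠ 0 := revPoly_ne_zero ha hP hdeg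
  have hRdeg : R.totalDegree ≤ 2 * d := totalDegree_revPoly_le a hdeg
  have h1 := hm R hR0 hRdeg
  rw [hRdef, aeval_revPoly a hdeg x y hy, norm_mul, norm_pow] at h1
  rw [← hRdef] at h1
  -- lengths
  set L : ℝ := 1 + Real.log ((mvlen P : ℤ) : ℝ) with hL
  have hlenP1 : (1 : ℝ) ≤ ((mvlen P : ℤ) : ℝ) := by exact_mod_cast one_le_mvlen hP
  have hlogP : 0 ≤ Real.log ((mvlen P : ℤ) : ℝ) := Real.log_nonneg hlenP1
  have hL1 : 1 ≤ L := by rw [hL]; linarith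
  have hlenR1 : (1 : ℝ) ≤ ((mvlen R : ℤ) : ℝ) := by exact_mod_cast one_le_mvlen hR0
  have hlenR : ((mvlen R : ℤ) : ℝ) ≤ |(a : ℝ)| ^ d * ((mvlen P : ℤ) : ℝ) := by
    have h' : ((mvlen R : ℤ) : ℝ) ≤ ((|a| ^ d * mvlen P : ℤ) : ℝ) := by
      exact_mod_cast mvlen_revPoly_le ha hdeg
    simpa [Int.cast_mul, Int.cast_pow, Int.cast_abs] using h'
  have hlogR : 1 + Real.log ((mvlen R : ℤ) : ℝ) ≤ Λa * L := by
    have hlog := Real.log_le_log (by linarith) hlenR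
    rw [Real.log_mul (by positivity) (by linarith), Real.log_pow] at hlog
    rw [hΛa, hL]
    nlinarith [mul_nonneg hdla hlogP]
  have hlogR0 : 0 ≤ 1 + Real.log ((mvlen R : ℤ) : ℝ) := by
    linarith [Real.log_nonneg hlenR1]
  have hpowk : (1 + Real.log ((mvlen R : ℤ) : ℝ)) ^ k ≤ Λa ^ k * L ^ k := by
    rw [← mul_pow]; exact pow_le_pow_left₀ hlogR0 hlogR k
  have hLk1 : 1 ≤ L ^ k := one_le_pow₀ hL1
  -- divide by ‖y‖^d
  have hypos : 0 < ‖y‖ ^ d := pow_pos (norm_pos_iff.mpr hy) d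
  have h2 : Real.exp (-(C * (1 + Real.log ((mvlen R : ℤ) : ℝ)) ^ k)) / ‖y‖ ^ d ≤
      ‖aeval ![x, (a : ℂ) / y] P‖ := by
    rw [div_le_iff₀ hypos]; exact h1.trans_eq (mul_comm _ _)
  refine le_trans ?_ h2
  rw [le_div_iff₀ hypos]
  have hyd : ‖y‖ ^ d = Real.exp ((d : ℝ) * Real.log ‖y‖) := by
    rw [Real.exp_nat_mul, Real.exp_log (norm_pos_iff.mpr hy)]
  rw [hyd, ← Real.exp_add, Real.exp_le_exp]
  have hA : C * (1 + Real.log ((mvlen R : ℤ) : ℝ)) ^ k ≤ C * (Λa ^ k * L ^ k) :=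
    mul_le_mul_of_nonneg_left hpowk hC.le
  have hB : (d : ℝ) * Real.log ‖y‖ ≤ d * ly :=
    mul_le_mul_of_nonneg_left (le_abs_self _) (Nat.cast_nonneg _)
  have hC' : (d : ℝ) * ly ≤ d * ly * L ^ k := le_mul_of_one_le_right hdly hLk1
  nlinarith [hA, hB, hC']

end Rev

/-! ### §8b  `LogPowMeasure (e^{−2π}, π)` and the integer-anchor cells of Hyper37/40, binder-free -/

/-- `P(q₀) = 3/π ≠ 0`. -/
theorem ramanujanP_qπ_ne_zero : ramanujanP qπ ≠ 0 := by
  rw [ramanujanP_qπ]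
  exact div_ne_zero three_ne_zero (ofReal_ne_zero.mpr Real.pi_ne_zero)

/-- Nesterenko's pair in the `q`-chart: `θq = (e^{−2π}, π)`. -/
def θq : Fin 2 → ℂ := ![qπ, (Real.pi : ℂ)]

/-- **`LogPowMeasure (e^{−2π}, π)`, hypothesis-free** — the reversal `y ↦ 3 / y` of `logPowMeasure_theta2`. -/
theorem logPowMeasure_thetaq : LogPowMeasure θq := by
  have hπ : (Real.pi : ℂ) ≠ 0 := ofReal_ne_zero.mpr Real.pi_ne_zero
  have h := logPowMeasure_revScale (x := qπ) (y := ramanujanP qπ) ramanujanP_qπ_ne_zero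
    (a := 3) (by norm_num) (show LogPowMeasure ![qπ, ramanujanP qπ] from logPowMeasure_theta2)
  have e : (((3 : ℤ) : ℂ)) / ramanujanP qπ = (Real.pi : ℂ) := by
    rw [ramanujanP_qπ]; push_cast; field_simp
  rw [e] at h
  exact h

/-- `MvWeakMeasure (e^{−2π}, π)`, hypothesis-free. -/
theorem mvWeakMeasure_thetaq : MvWeakMeasure θq := logPowMeasure_thetaq.mvWeakMeasure

/-- `θq ⊂ ℚ(z, e^z, i)` as soon as `π ∈ span_ℤ z`. -/
theorem thetaq_mem {N : ℕ} {z : Fin N → ℂ} (hπ : (Real.pi : ℂ) ∈ Submodule.span ℤ (Set.range z)) :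
    ∀ i, θq i ∈ adjoin ℚ (SFset z ∪ {I}) := by
  have he : cexp (Real.pi : ℂ) ∈ adjoin ℚ (SFset z ∪ {I}) := cexp_mem_adjoin_of_mem_span hπ
  intro i
  match i with
  | 0 =>
    show qπ ∈ _
    rw [qπ_eq_zpow]; exact zpow_mem he _
  | 1 => exact mem_adjoin_of_mem_span hπ

/-- **Hyper40's `sb_three_of_piIntAnchor'` WITHOUT `h52`**: `span_ℤ z ∋ π, N₁` (`N₁ ∈ ℤ ∖ 0`) and `z`
hyper-lin-Liouville ⇒ `SB 3 z` — the measured pair is now `θq = (e^{−2π}, π)` (anchors `W₁ = N₁`, `W₂ = x₁`). -/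
theorem sb_three_of_piIntAnchor_free {z : Fin 3 → ℂ} (hz : LinearIndependent ℚ z)
    (hH : HyperLinLiouville z) (hA : LatCell.HasPiIntAnchor z) : SB 3 z := by
  obtain ⟨N₁, hN₁, h₁, h₂⟩ := hA
  exact LatCell.sb_three_of_measuredLatAnchor hz hH mvWeakMeasure_thetaq (thetaq_mem h₂)
    (MvPolynomial.C N₁) (MvPolynomial.X 1) (LatCell.C_indep_X_one hN₁) (by simpa [θq] using h₁)
    (by simpa [θq] using h₂)

/-- **THE LITERAL M2 CELL `(1, π, y)`, ANY `y` — HYPOTHESIS-FREE** (Hyper40's `sb_three_one_pi_any'` without `h52`). -/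
theorem sb_three_one_pi_any_free {y : ℂ}
    (hz : LinearIndependent ℚ (LatCell.latTriple 1 (Real.pi : ℂ) y))
    (hH : HyperLinLiouville (LatCell.latTriple 1 (Real.pi : ℂ) y)) :
    SB 3 (LatCell.latTriple 1 (Real.pi : ℂ) y) :=
  sb_three_of_piIntAnchor_free hz hH (LatCell.hasPiIntAnchor_latTriple_one_pi y)

end Summit.Schanuel.Schanuel.Theorems.RootDecomp1KPiScale

end
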